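import Summits.ResolutionOfSingularities.ResolutionOfSingularities.Theorems.HilbertSamuelEliminationSigmaMaxModificationsCorridor3WLadderIsoInsepE2NearCubic
import Summits.ResolutionOfSingularities.ResolutionOfSingularities.Theorems.HilbertSamuelEliminationSigmaMaxModificationsCorridor3WLadderAlgIsolatedScheme
import Summits.ResolutionOfSingularities.ResolutionOfSingularities.Theorems.HilbertSamuelEliminationSigmaMaxModificationsCorridor3WLadderAlgIsolatedHypersurface
import Literature.AlgebraicGeometry.Resolution.RegularLocalRingsNormal
import HarnessLib

/-!
# [OURS · L1 W4.2] E2 chart calculus, brick 17a: (N3c) «A HYPERSURFACE POINT SINGULAR ALONG A CURVE IS NOT ISOLATED IN THE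
# HILBERT–SAMUEL LOCUS», and the prime `𝔮 = (u, v, c_j)` of the exceptional line when the cubic cone contains the line
# (crux chain w42, cell k2 `T3insep` = `stub_isoInsepTower`; `--supports stmt-ResolutionOfSingularities-19249`)

OURS (cell res-hironaka, slot W4.2, seat res-D-pv-042; OWN OBJECT TUO 2026-08-27 18:19Z, (N3) continuation of the NJ/RC
dictionary); NOT a statement of [Hironaka2017] nor of [CossartJannsenSaito2020] / [CossartPiltant2008]. AI-drafted, weaker than
expert review. PROOF file, def-free, fact-free.

* `exists_ringEquiv_localizationAtPrime_map_quotient` — for `σ : L ↠ A` and a prime `P ⊇ ker σ` of `L`: `A_{σ(P)} ≅ L_P/(ker σ)L_P`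
  (the tree's `IdeasL1C4.exists_ringEquiv_localization_quotient` read through `A ≅ L/ker σ` and `Localization.localRingEquiv`).
* `not_isIsolatedInHSMaxLocus_of_mem_prime_sq` — **(N3c), local form**: if `𝒪_{X,x} ≅ L/(g)` with `L` regular local of dimension
  `e ≤ N + 1`, `g ∈ 𝔪² ∖ 𝔪³`, and `g ∈ P²` for a prime `P ≠ 𝔪` of `L`, then `x` is NOT isolated in `X_max` at level `N`: the
  generization `ζ ⤳ x` cut out by `σ(P)` has `𝒪_{X,ζ} ≅ L_P/(g)` with `g ∈ (PL_P)^m ∖ (PL_P)^{m+1}`, `m ≥ 2`, so (Bennett, tree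
  `hsFun_eq_hypersurfaceHFe_of_stalk_ringEquiv`) `H^N_X(ζ) = hypersurfaceHFe (N+1) m ≥ hypersurfaceHFe (N+1) 2 = H^N_X(x)`,
  contradicting `IdeasL1C4.eq_of_isIsolatedInHSMaxLocus_of_hsFun_le`.
* `E2Chart.exists_prime_of_lineRestriction_eq_zero` — in a chart `B ↠ κ[T]` (`π`, `ker π ⊆ (t)`, `π u = T_a`, `π v = T_b`, `π t = 0`,
  the variables other than the surviving one `T_c` being `T_a, T_b`): if the restriction of `π G` to the line `{T_a = T_b = 0}`
  vanishes then `𝔮 = ker(B → κ[T] → κ[T_c])` is a prime with `u, v, t, G ∈ 𝔮 ⊆ (u, v, t)`, hence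
  `h′ = ĉ(u² + λ̂v²) + t·G ∈ 𝔮²` — the strict transform is singular all along the exceptional line.

## References

* V. Cossart, U. Jannsen, S. Saito, LNM 2270 (2020): Def. 2.28, Thm. 2.3 (Bennett), Def. 13.3. [CossartJannsenSaito2020]
* The Stacks Project, Tag 01J7. [StacksProject]
-/

noncomputable section

set_option linter.dupNamespace false

open scoped Classical
open IsLocalRing MvPolynomial AlgebraicGeometry
open Literature.AlgebraicGeometry.Resolution Literature.AlgebraicGeometry.CossartJannsenSaito2020
open Literature.RingTheory.HilbertSamuel
open Summit.ResolutionOfSingularities.ResolutionOfSingularities.Theorems.SigmaMaxModificationsCorridor3.Helpers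

universe u v w

namespace Summit.ResolutionOfSingularities.ResolutionOfSingularities.Cruxes.SigmaMaxModifications.IdeasL1C6

/-! ### §1. Localising a hypersurface presentation at a prime -/

/-- **`A_{σ(P)} ≅ L_P/(ker σ)L_P`.** For a surjection `σ : L ↠ A` and a prime `P` of `L` containing `ker σ`, the image `σ(P)` is a
prime of `A` and the localisation of `A` at it is the quotient of `L_P` by the extension of `ker σ`.
[OURS · L1 W4.2 · k2 · E2 chart calculus, brick 17a] [folklore] -/
theorem exists_ringEquiv_localizationAtPrime_map_quotient {L A : Type u} [CommRing L] [CommRing A] (σ : L →+* A)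
    (hσ : Function.Surjective σ) (P : Ideal L) [P.IsPrime] (hker : RingHom.ker σ ≤ P) :
    ∃ _ : (P.map σ).IsPrime, Nonempty (Localization.AtPrime (P.map σ) ≃+*
      Localization.AtPrime P ⧸ (RingHom.ker σ).map (algebraMap L (Localization.AtPrime P))) := by
  haveI hQ : (P.map σ).IsPrime := Ideal.map_isPrime_of_surjective hσ hker
  let e : L ⧸ RingHom.ker σ ≃+* A := RingHom.quotientKerEquivOfSurjective hσ
  haveI hQ₀ : (P.map (Ideal.Quotient.mk (RingHom.ker σ))).IsPrime :=
    Ideal.map_isPrime_of_surjective Ideal.Quotient.mk_surjective (by rw [Ideal.mk_ker]; exact hker)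
  have hP : P = (P.map (Ideal.Quotient.mk (RingHom.ker σ))).comap (Ideal.Quotient.mk (RingHom.ker σ)) := by
    rw [Ideal.comap_map_of_surjective _ Ideal.Quotient.mk_surjective, ← RingHom.ker_eq_comap_bot, Ideal.mk_ker,
      sup_eq_left.mpr hker]
  obtain ⟨ε₁⟩ := IdeasL1C4.exists_ringEquiv_localization_quotient (RingHom.ker σ)
    (P.map (Ideal.Quotient.mk (RingHom.ker σ))) P hP
  have hIJ : P.map (Ideal.Quotient.mk (RingHom.ker σ)) = (P.map σ).comap e := by
    ext y
    obtain ⟨y, rfl⟩ := Ideal.Quotient.mk_surjective y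
    rw [Ideal.mem_comap, Ideal.mem_map_iff_of_surjective _ Ideal.Quotient.mk_surjective,
      show e (Ideal.Quotient.mk (RingHom.ker σ) y) = σ y from RingHom.quotientKerEquivOfSurjective_apply_mk hσ y,
      Ideal.mem_map_iff_of_surjective σ hσ]
    constructor
    · rintro ⟨x, hx, hxy⟩
      refine ⟨x, hx, ?_⟩
      rw [Ideal.Quotient.eq, RingHom.sub_mem_ker_iff] at hxy
      exact hxy
    · rintro ⟨x, hx, hxy⟩
      refine ⟨x, hx, ?_⟩
      rw [Ideal.Quotient.eq, RingHom.sub_mem_ker_iff]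
      exact hxy
  exact ⟨hQ, ⟨(ε₁.trans (Localization.localRingEquiv _ (P.map σ) e hIJ)).symm⟩⟩

/-! ### §2. (N3c), local form: singular along a curve ⇒ not isolated in the Hilbert–Samuel locus -/

/-- **(N3c) — A HYPERSURFACE POINT SINGULAR ALONG A CURVE IS NOT ISOLATED IN `X_max`.** Let `X` be locally noetherian, `x ∈ X` with
`𝒪_{X,x} ≅ L/(g)` (`σ : L ↠ 𝒪_{X,x}`, `ker σ = (g)`), `L` regular local of dimension `e ≤ N + 1`, `g ∈ 𝔪² ∖ 𝔪³` (a double point). If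
`g ∈ P²` for a prime `P ≠ 𝔪` of `L`, then `x` is not isolated in the Hilbert–Samuel locus `X_max` at level `N`: along the
generization `ζ ⤳ x` with `𝒪_{X,ζ} ≅ L_P/(g)` the multiplicity is still `≥ 2`, so `H^N_X(ζ) ≥ H^N_X(x)` by Bennett's formula
`H^N = hypersurfaceHFe (N+1) (mult)`. [OURS · L1 W4.2 · k2 · E2 chart calculus, brick 17a]
[cite: CossartJannsenSaito2020, Thm. 2.3, Def. 2.28, Def. 13.3] [cite: StacksProject, Tag 01J7] -/
theorem not_isIsolatedInHSMaxLocus_of_mem_prime_sq {X : Scheme.{u}} [IsLocallyNoetherian X] {x : X} {N e : ℕ}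
    {L : Type u} [CommRing L] [IsRegularLocalRing L] (hL : ringKrullDim L = e) (heN : e ≤ N + 1)
    (σ : L →+* X.presheaf.stalk x) (hσ : Function.Surjective σ) {g : L} (hker : RingHom.ker σ = Ideal.span {g})
    (hg2 : g ∈ maximalIdeal L ^ 2) (hg3 : g ∉ maximalIdeal L ^ 3) (P : Ideal L) [P.IsPrime] (hP : P ≠ maximalIdeal L)
    (hgP : g ∈ P ^ 2) : ¬ IsIsolatedInHSMaxLocus X N x := by
  intro hiso
  haveI : IsDomain L := isDomain_of_isRegularLocalRing L
  -- the Hilbert–Samuel function at `x`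
  let εx : X.presheaf.stalk x ≃+* L ⧸ Ideal.span {g} :=
    ((Ideal.quotEquivOfEq hker).symm.trans (RingHom.quotientKerEquivOfSurjective hσ)).symm
  have hg3' : g ∉ maximalIdeal L ^ (2 + 1) := hg3
  have hx : Scheme.hsFun X N x = hypersurfaceHFe (N + 1) 2 :=
    hsFun_eq_hypersurfaceHFe_of_stalk_ringEquiv hL heN (by norm_num) hg2 hg3' εx
  -- the prime `σ(P)` of the stalk
  have hgP1 : g ∈ P := Ideal.pow_le_self two_ne_zero hgP
  have hkerP : RingHom.ker σ ≤ P := by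
    rw [hker, Ideal.span_singleton_le_iff_mem]
    exact hgP1
  obtain ⟨hQ, ⟨εQ⟩⟩ := exists_ringEquiv_localizationAtPrime_map_quotient σ hσ P hkerP
  have hQne : P.map σ ≠ maximalIdeal (X.presheaf.stalk x) := by
    intro hQ'
    apply hP
    have h1 : (P.map σ).comap σ = P := by
      rw [Ideal.comap_map_of_surjective σ hσ, ← RingHom.ker_eq_comap_bot, sup_eq_left.mpr hkerP]
    rw [← h1, hQ']
    haveI := Ideal.comap_isMaximal_of_surjective σ hσ (K := maximalIdeal (X.presheaf.stalk x))
    exact IsLocalRing.eq_maximalIdeal inferInstance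
  -- the generization `ζ`
  obtain ⟨ζ, hζx, hζne, ⟨eζ⟩, -⟩ := IdeasL1C4.exists_specializes_hsFun_eq_of_prime x (P.map σ) hQne
  -- `𝒪_{X,ζ} ≅ L_P/(g)`
  rw [hker, Ideal.map_span, Set.image_singleton] at εQ
  haveI : IsRegularLocalRing (Localization.AtPrime P) := isRegularLocalRing_localization_atPrime L P
  obtain ⟨e', he'⟩ := exists_nat_cast_eq_ringKrullDim (R := Localization.AtPrime P)
  have he'le : e' ≤ e := by
    have h1 : ringKrullDim (Localization.AtPrime P) ≤ ringKrullDim L := by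
      rw [IsLocalization.AtPrime.ringKrullDim_eq_height P (Localization.AtPrime P)]
      exact Ideal.height_le_ringKrullDim_of_isPrime
    rw [he', hL] at h1
    exact_mod_cast h1
  have hinj : Function.Injective (algebraMap L (Localization.AtPrime P)) :=
    IsLocalization.injective (Localization.AtPrime P) P.primeCompl_le_nonZeroDivisors
  have hg0 : g ≠ 0 := fun h0 => hg3 (by rw [h0]; exact zero_mem _)
  have hg'0 : algebraMap L (Localization.AtPrime P) g ≠ 0 := fun h0 => hg0 (hinj (by rw [h0, map_zero]))
  have hg'2 : algebraMap L (Localization.AtPrime P) g ∈ maximalIdeal (Localization.AtPrime P) ^ 2 := by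
    rw [← Localization.AtPrime.map_eq_maximalIdeal, ← Ideal.map_pow]
    exact Ideal.mem_map_of_mem _ hgP
  obtain ⟨m, hm1, hm2⟩ := exists_mem_pow_and_not_mem_pow_succ hg'0
  have h2m : 2 ≤ m := by
    by_contra hlt
    exact hm2 (Ideal.pow_le_pow_right (by omega) hg'2)
  have hζ : Scheme.hsFun X N ζ = hypersurfaceHFe (N + 1) m :=
    hsFun_eq_hypersurfaceHFe_of_stalk_ringEquiv he' (he'le.trans heN) (by omega) hm1 hm2 (eζ.trans εQ)
  -- comparison
  have hle : Scheme.hsFun X N x ≤ Scheme.hsFun X N ζ := by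
    rw [hx, hζ]
    exact hypersurfaceHFe_mono_right _ h2m
  exact hζne (IdeasL1C4.eq_of_isIsolatedInHSMaxLocus_of_hsFun_le hiso hζx hle)

end Summit.ResolutionOfSingularities.ResolutionOfSingularities.Cruxes.SigmaMaxModifications.IdeasL1C6

/-! ### §3. The prime of the exceptional line when the cubic cone contains it -/

namespace Summit.ResolutionOfSingularities.ResolutionOfSingularities.Cruxes.SigmaMaxModifications.IdeasL1C6.E2Chart

/-- **THE CONE CONTAINS THE LINE ⇒ `h′ ∈ 𝔮²` FOR THE PRIME `𝔮 = (u, v, t)` OF THE LINE.** In a chart `π : B ↠ κ[T_k]` with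
`ker π ⊆ (t)`, `π u = T_a`, `π v = T_b`, `π t = 0`, where `T_a, T_b` are all the variables but the surviving one `T_c`: if the
restriction `(π G)(T_a ↦ 0, T_b ↦ 0, T_c ↦ X)` vanishes, then `𝔮 := ker(B → κ[T] → κ[X])` is a prime ideal with
`u, v, t, G ∈ 𝔮 ⊆ (u, v, t)`, and `h′ = ĉ(u² + λ̂v²) + t·G ∈ 𝔮²`. [OURS · L1 W4.2 · k2 · E2 chart calculus, brick 17a] [folklore] -/
theorem exists_prime_of_lineRestriction_eq_zero {B : Type u} [CommRing B] {κ : Type v} [Field κ] {ι : Type w}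
    (π : B →+* MvPolynomial ι κ) (hπ : Function.Surjective π) {u v t G cc' lam' h' : B} {kc a b : ι} (ha : a ≠ kc)
    (hb : b ≠ kc) (hab : ∀ k : ι, k ≠ kc → k = a ∨ k = b) (hπu : π u = X a) (hπv : π v = X b) (hπt : π t = 0)
    (hker : RingHom.ker π ≤ Ideal.span {t}) (heq : h' = cc' * (u ^ 2 + lam' * v ^ 2) + t * G)
    (hρ : MvPolynomial.aeval (fun k : ι => if k = kc then (Polynomial.X : Polynomial κ) else 0) (π G) = 0) :
    ∃ 𝔮 : Ideal B, 𝔮.IsPrime ∧ u ∈ 𝔮 ∧ v ∈ 𝔮 ∧ t ∈ 𝔮 ∧ G ∈ 𝔮 ∧ h' ∈ 𝔮 ^ 2 ∧ 𝔮 ≤ Ideal.span {u, v, t} := by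
  let ρ : MvPolynomial ι κ →+* Polynomial κ :=
    (MvPolynomial.aeval (fun k : ι => if k = kc then (Polynomial.X : Polynomial κ) else 0)).toRingHom
  have hρapp : ∀ f, ρ f = MvPolynomial.aeval (fun k : ι => if k = kc then (Polynomial.X : Polynomial κ) else 0) f :=
    fun f => rfl
  have hmem : ∀ z : B, z ∈ RingHom.ker (ρ.comp π) ↔ ρ (π z) = 0 := fun z => by rw [RingHom.mem_ker, RingHom.comp_apply]
  have hu : u ∈ RingHom.ker (ρ.comp π) := by rw [hmem, hπu, hρapp, MvPolynomial.aeval_X, if_neg ha]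
  have hv : v ∈ RingHom.ker (ρ.comp π) := by rw [hmem, hπv, hρapp, MvPolynomial.aeval_X, if_neg hb]
  have ht : t ∈ RingHom.ker (ρ.comp π) := by rw [hmem, hπt, map_zero]
  have hG : G ∈ RingHom.ker (ρ.comp π) := by rw [hmem, hρapp, hρ]
  refine ⟨RingHom.ker (ρ.comp π), RingHom.ker_isPrime _, hu, hv, ht, hG, ?_, ?_⟩
  · have htG : t * G ∈ RingHom.ker (ρ.comp π) ^ 2 := by rw [pow_two]; exact Ideal.mul_mem_mul ht hG
    rw [heq]
    exact Ideal.add_mem _ (Ideal.mul_mem_left _ _ (Ideal.add_mem _ (Ideal.pow_mem_pow hu 2)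
      (Ideal.mul_mem_left _ _ (Ideal.pow_mem_pow hv 2)))) htG
  · intro z hz
    have hρz : ρ (π z) = 0 := (hmem z).mp hz
    -- `π z ∈ (T_a, T_b) = π (u, v)`
    have hvarsI : ∀ k : ι, k ≠ kc → (X k : MvPolynomial ι κ) ∈ Ideal.span {X a, X b} := fun k hk => by
      rcases hab k hk with rfl | rfl
      · exact Ideal.subset_span (Set.mem_insert _ _)
      · exact Ideal.subset_span (Set.mem_insert_of_mem _ (Set.mem_singleton _))
    have hI : π z ∈ Ideal.span {(X a : MvPolynomial ι κ), X b} := by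
      have h := aeval_sub_aeval_mem_of_forall_sub_mem (Ideal.span {(X a : MvPolynomial ι κ), X b})
        (a := fun k : ι => (X k : MvPolynomial ι κ)) (b := fun k : ι => if k = kc then (X kc : MvPolynomial ι κ) else 0)
        (fun k => by
          by_cases hk : k = kc
          · subst hk; simp
          · simp only [if_neg hk, sub_zero]; exact hvarsI k hk) (π z)
      have hsec : MvPolynomial.aeval (fun k : ι => if k = kc then (X kc : MvPolynomial ι κ) else 0) (π z) = 0 := by
        have hfun : (fun k : ι => if k = kc then (X kc : MvPolynomial ι κ) else 0) =
            fun k : ι => Polynomial.aeval (X kc : MvPolynomial ι κ) (if k = kc then (Polynomial.X : Polynomial κ) else 0) := by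
          funext k
          by_cases hk : k = kc
          · rw [if_pos hk, if_pos hk, Polynomial.aeval_X]
          · rw [if_neg hk, if_neg hk, map_zero]
        rw [hfun, ← MvPolynomial.comp_aeval, AlgHom.comp_apply, ← hρapp, hρz, map_zero]
      rwa [MvPolynomial.aeval_X_left_apply, hsec, sub_zero] at h
    have hIeq : Ideal.span {(X a : MvPolynomial ι κ), X b} = (Ideal.span {u, v}).map π := by
      rw [Ideal.map_span, Set.image_pair, hπu, hπv]
    rw [hIeq] at hI
    have hz' : z ∈ ((Ideal.span {u, v}).map π).comap π := Ideal.mem_comap.mpr hI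
    rw [Ideal.comap_map_of_surjective π hπ, ← RingHom.ker_eq_comap_bot] at hz'
    obtain ⟨w, hw, k, hk, rfl⟩ := Submodule.mem_sup.mp hz'
    have h1 : Ideal.span {u, v} ≤ Ideal.span ({u, v, t} : Set B) :=
      Ideal.span_mono (Set.insert_subset_insert (Set.singleton_subset_iff.mpr (Set.mem_insert _ _)))
    have h2 : Ideal.span {t} ≤ Ideal.span ({u, v, t} : Set B) :=
      Ideal.span_mono (Set.singleton_subset_iff.mpr (Set.mem_insert_of_mem _ (Set.mem_insert_of_mem _ (Set.mem_singleton _))))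
    exact Ideal.add_mem _ (h1 hw) (h2 (hker hk))

end Summit.ResolutionOfSingularities.ResolutionOfSingularities.Cruxes.SigmaMaxModifications.IdeasL1C6.E2Chart

end
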